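import Summits.QuantumFields.BalabanUV.Beta.D1BFx.RestLegContourSum
import Summits.QuantumFields.BalabanUV.Beta.D1BFx.GluonLegProfileD1

/-!
# `BalabanUV.Beta.D1BFx.RestLegContourSumD1` — road «BF-x» for binder row D1, slot (K), PART 24 letter L-B″, FILE 1∕2: **THE `x′`-DIFFERENCE OF THE FINE LEG's
# STRAIGHT-CONTOUR SUM IS `O(n²)` WITH SCALE-`n` DECAY** — the d1 twin of this lineage's «SAND-ENV» FILE 1 `RestLegContourSum.exists_contourSum_Ga_le` (`n³`): ONE `(KQ′, δ)` with
# `|contourSum n (Ga-column at x′ + e_ρ′) m′ y₀ − contourSum n (Ga-column at x′) m′ y₀| ≤ n²·KQ′·e^{−(δ∕(2n))‖x′ − n•y₀‖∞}` for every `n ≥ 1`, modulo [B5, Prop. 1.2] ∧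
# [B5, (1.126)–(1.127)] BY NAME (they enter ONLY as the hypotheses `h12 ∧ h126` of leaf-04's d1 profile `GluonLegProfileD1.exists_abs_Ga_diff_le_profile`)

HONEST DEPENDENCY (cell records, verbatim): «continuum YM on T⁴ ⇐ BetaPertH ∧ nine spine estimates (0/9 proved); BetaPertH ⇐ (D1) ∧ (D4) ∧
CAP+tail; G-an2-4 gates asym, D1 and NE2/3/4.»  HONEST FRAMING (cell contract, verbatim): «discharging `BetaPertH` makes Bałaban's UV stability
UNCONDITIONAL — a real constructive-QFT result; it is NOT the continuum limit and NOT the Clay problem.»  THIS MODULE DISCHARGES NOTHING of the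
wall: [folklore] lattice bookkeeping BY NAME — the d1 PROFILE `kG′·e^{−(δ∕n)‖·‖∞}∕nrm³` of the fine leg's unit differences (leaf-04), leaf-04-g9's HLS kit
`LatticeHLSRadial.sum_exp_div_nrm_pow_le` at `p = 3` (one power of `n` per box instead of two), and «SAND-ENV» FILE 1's leg geometry (`supNorm_leg_le`, `exp_supNorm_shift_le`).
No definition, no `def … : Prop`, nothing cited, 0 sorry.  NO (1.22) row; 0∕4 row-D1 binders; (K) NOT closed; NOT D1, NOT `BetaPertH`, NOT continuum, NOT Clay.

ABSOLUTE RULE (cell charter, verbatim): «No internally-minted statement may enter as a cited fact. Every hypothesis is either kernel-proved in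
this package or a verbatim quotation of a PUBLISHED theorem with page reference. The manuscript(s) under audit are NOT citable for their own
disputed steps — they are the thing under adjudication; programme-internal (2001/route/tribunal) claims are never citable.»

CONTENT.
* [folklore] **`sum_box_profile_cube_le`** (one straight contour's box against the d1 profile: `Σ_{b ∈ box 4 n} e^{−(δ∕n)‖x′ − leg‖∞}∕nrm(x′ − leg)³ ≤ n·(217 + 432∕δ)`).
* [mod `h12 ∧ h126`] **`exists_contourSum_Ga_diff_le`** (`KQ′ = kG′·e^{δ}·(217 + 864∕δ)`; the profile at half rate feeds the box lemma, the other half and the leg offsets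
  `≤ 2n` give the block-scale decay; × the `n` steps).
FILE 2∕2 `RestLegSandwichMixed` multiplies this by L-h PART 1's `n⁻⁶` gradient of the `ℋ_R` column: `n⁻⁶·n² = n⁻⁴` = L-B″.
Unit `b2b-balaban-beta-d1-formalise-leaf-01` (gen 30), D1 formalisation swarm LEAF PROVER 01, road «BF-x» («SAND-ENV» lineage); INTENT-3 [D1LEAF01-G30-INTENT-3], FILE 1∕2.
-/

noncomputable section

open Finset
open scoped BigOperators
open Literature.MathematicalPhysics.QuantumFieldTheory.Balaban1983to89
open Literature.MathematicalPhysics.QuantumFieldTheory.Balaban1983to89.Beta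
open AffineAveraging (box toSite unitVec unitVec_apply contourSum)
open ExpKernelCalculus (Site MKer)
open DyadicShell (Pt)
open PoissonInterior (nrm nrm_pos supNorm supNorm_neg nrm_neg)
open VectorTailsLoc (fam kfam)
open Summit.QuantumFields.BalabanUV.Beta.D1BFx.GluonLeg (Ga)
open Summit.QuantumFields.BalabanUV.Beta.D1BFx.GluonLegProfileD1 (exists_abs_Ga_diff_le_profile)
open Summit.QuantumFields.BalabanUV.Beta.D1BFx.LatticeHLSRadial (sum_exp_div_nrm_pow_le)
open Summit.QuantumFields.BalabanUV.Beta.D1BFx.RestLegContourSum (supNorm_leg_le exp_supNorm_shift_le)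
open Summit.QuantumFields.BalabanUV.Beta.D1BFx.FrozenLegTails (nOf MOf hn1)

namespace Summit.QuantumFields.BalabanUV.Beta.D1BFx.RestLegContourSumD1

/-! ## §1 The `x′`-difference of the fine leg's contour sum is `O(n²)` with scale-`n` decay -/

section ProfileAux

/-- [folklore] **ONE STRAIGHT CONTOUR'S BOX AGAINST THE d1 PROFILE**: for `n ≥ 1`, `0 < δ`, a coarse point `y₀`, a step `s`, a direction `m′` and a fine point `x′`,
`Σ_{b ∈ box 4 n} e^{−(δ∕n)‖x′ − (n•y₀ + b + s•e)‖∞}∕nrm(x′ − (n•y₀ + b + s•e))³ ≤ n·(217 + 432∕δ)` — leaf-04-g9's HLS kit `sum_exp_div_nrm_pow_le` at `p = 3` on the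
(injective) image of the box (the template is `RestLegContourSum.sum_box_profile_le`, `p = 2`). -/
theorem sum_box_profile_cube_le {δ : ℝ} (hδ : 0 < δ) (n : ℕ) [NeZero n] (y₀ x' : Fin 4 → ℤ) (s : ℕ) (m' : Fin 4) :
    ∑ b ∈ box 4 n, Real.exp (-(δ / n) * (supNorm (d := 4) (x' - ((n : ℤ) • y₀ + toSite b + (s : ℤ) • unitVec m')) : ℝ))
        / nrm (d := 4) (x' - ((n : ℤ) • y₀ + toSite b + (s : ℤ) • unitVec m')) ^ 3
      ≤ (n : ℝ) * (217 + 432 / δ) := by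
  have hn1 : 1 ≤ n := NeZero.one_le
  have hn : (1 : ℝ) ≤ n := by exact_mod_cast hn1
  have hnpos : (0 : ℝ) < n := by positivity
  set φ : (Fin 4 → ℕ) → (Fin 4 → ℤ) := fun b => (n : ℤ) • y₀ + toSite b + (s : ℤ) • unitVec m' with hφ
  have hinj : Set.InjOn φ (box 4 n : Set (Fin 4 → ℕ)) := by
    intro b _ b' _ h
    have h' : toSite b = toSite b' := by
      have := congrArg (fun p => p - (n : ℤ) • y₀ - (s : ℤ) • unitVec m') h
      simpa [hφ] using this
    funext i
    have hi := congr_fun h' i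
    simp only [toSite] at hi
    exact_mod_cast hi
  have e : ∑ b ∈ box 4 n, Real.exp (-(δ / n) * (supNorm (d := 4) (x' - φ b) : ℝ)) / nrm (d := 4) (x' - φ b) ^ 3
      = ∑ p ∈ (box 4 n).image φ, Real.exp (-(δ / n) * (supNorm (d := 4) (p - x') : ℝ)) / nrm (d := 4) (p - x') ^ 3 := by
    rw [Finset.sum_image hinj]
    refine Finset.sum_congr rfl fun b _ => ?_
    rw [← neg_sub (φ b) x', supNorm_neg, nrm_neg]
  rw [e]
  have hkit := sum_exp_div_nrm_pow_le (d := 4) (by norm_num) (ε := δ / n) (by positivity) (p := 3) (by norm_num) ((box 4 n).image φ) x'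
  refine hkit.trans ?_
  have e2 : (1 : ℝ) + 2 * (4 : ℕ) * 3 ^ (4 - 1) * (((4 - 1 - 3 : ℕ).factorial : ℝ) * (2 / (δ / n)) ^ (4 - 1 - 3) * (1 + 2 / (δ / n)))
      = 217 + 432 / δ * n := by
    rw [show (4 : ℕ) - 1 - 3 = 0 by norm_num, Nat.factorial_zero, pow_zero, Nat.cast_one, one_mul]
    field_simp
    ring
  rw [e2]
  have hδ' : 0 ≤ 432 / δ := by positivity
  nlinarith [mul_le_mul_of_nonneg_left hn (show (0:ℝ) ≤ 217 by norm_num), hδ']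

end ProfileAux

section Profile

variable {a : ℝ} (ha : 0 < a)
include ha

/-- [mod `h12 ∧ h126`] **THE `x′`-DIFFERENCE OF THE CONTOUR SUM OF THE FINE LEG's COLUMN IS `O(n²)` WITH SCALE-`n` DECAY** (`GluonLegProfileD1.exists_abs_Ga_diff_le_profile`):
ONE pair `(KQ′, δ)` such that for EVERY block side `n ≥ 1`, fine point `x′`, direction `ρ′`, coarse point `y₀` and colours `m′ κ′`,
`|contourSum n (fun l y ↦ Ga n a y (x′ + e_ρ′) l κ′) m′ y₀ − contourSum n (fun l y ↦ Ga n a y x′ l κ′) m′ y₀| ≤ n²·KQ′·e^{−(δ∕(2n))·‖x′ − n•y₀‖∞}`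
(`KQ′ = kG′·e^{δ}·(217 + 864∕δ)`: the profile at half rate feeds `sum_box_profile_cube_le`, the other half and the leg offsets `≤ 2n` give the block-scale decay; × the `n` steps). -/
theorem exists_contourSum_Ga_diff_le (h12 : B5.Prop12Printed (fam nOf hn1 MOf a ha)) (h126 : B5.Kernel126_127Printed (kfam nOf MOf)) :
    ∃ KQ δ : ℝ, 0 < δ ∧ 0 ≤ KQ ∧ ∀ (n : ℕ) [NeZero n] (x' y₀ : Fin 4 → ℤ) (m' κ' ρ' : Fin 4),
      |contourSum n (fun l y => Ga n a y (x' + unitVec ρ') l κ') m' y₀ - contourSum n (fun l y => Ga n a y x' l κ') m' y₀|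
        ≤ (n : ℝ) ^ 2 * KQ * Real.exp (-(δ / 2 / n) * (supNorm (d := 4) (x' - (n : ℤ) • y₀) : ℝ)) := by
  obtain ⟨kG, δ, hδ, hkG, hprof⟩ := exists_abs_Ga_diff_le_profile a ha h12 h126
  refine ⟨kG * Real.exp δ * (217 + 432 / (δ / 2)), δ, hδ, by positivity, fun n _ x' y₀ m' κ' ρ' => ?_⟩
  have hn1 : 1 ≤ n := NeZero.one_le
  have hn : (1 : ℝ) ≤ n := by exact_mod_cast hn1
  have hnpos : (0 : ℝ) < n := by positivity
  unfold AffineAveraging.contourSum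
  rw [← Finset.sum_sub_distrib]
  simp only [← Finset.sum_sub_distrib]
  -- termwise: d1 profile, split the exponential in two halves, move one half to the block scale
  have hterm : ∀ b ∈ box 4 n, ∀ s ∈ Finset.range n,
      |Ga n a ((n : ℤ) • y₀ + toSite b + (s : ℤ) • unitVec m') (x' + unitVec ρ') m' κ' - Ga n a ((n : ℤ) • y₀ + toSite b + (s : ℤ) • unitVec m') x' m' κ'|
        ≤ kG * Real.exp δ * Real.exp (-(δ / 2 / n) * (supNorm (d := 4) (x' - (n : ℤ) • y₀) : ℝ))
          * (Real.exp (-(δ / 2 / n) * (supNorm (d := 4) (x' - ((n : ℤ) • y₀ + toSite b + (s : ℤ) • unitVec m')) : ℝ))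
            / nrm (d := 4) (x' - ((n : ℤ) • y₀ + toSite b + (s : ℤ) • unitVec m')) ^ 3) := by
    intro b hb s hs
    set p : Fin 4 → ℤ := (n : ℤ) • y₀ + toSite b + (s : ℤ) • unitVec m' with hp
    refine (hprof n p x' m' κ' ρ').trans ?_
    have hsplit : Real.exp (-(δ / n) * (supNorm (d := 4) (x' - p) : ℝ))
        = Real.exp (-(δ / 2 / n) * (supNorm (d := 4) (x' - p) : ℝ)) * Real.exp (-(δ / 2 / n) * (supNorm (d := 4) (x' - p) : ℝ)) := by
      rw [← Real.exp_add]; congr 1; ring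
    have hp' : p = (n : ℤ) • y₀ + (toSite b + (s : ℤ) • unitVec m') := by rw [hp, add_assoc]
    have hshift := exp_supNorm_shift_le (ε := δ / 2 / n) (by positivity) x' ((n : ℤ) • y₀) (toSite b + (s : ℤ) • unitVec m')
    rw [← hp'] at hshift
    have hleg := supNorm_leg_le n hb hs m'
    have hoff : Real.exp (δ / 2 / n * (supNorm (d := 4) (toSite b + (s : ℤ) • unitVec m') : ℝ)) ≤ Real.exp δ := by
      apply Real.exp_le_exp.2
      have : δ / 2 / n * (supNorm (d := 4) (toSite b + (s : ℤ) • unitVec m') : ℝ) ≤ δ / 2 / n * (2 * n) :=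
        mul_le_mul_of_nonneg_left hleg (by positivity)
      have e : δ / 2 / n * (2 * (n : ℝ)) = δ := by field_simp
      linarith
    have h1 : Real.exp (-(δ / 2 / n) * (supNorm (d := 4) (x' - p) : ℝ))
        ≤ Real.exp δ * Real.exp (-(δ / 2 / n) * (supNorm (d := 4) (x' - (n : ℤ) • y₀) : ℝ)) :=
      hshift.trans (mul_le_mul_of_nonneg_right hoff (Real.exp_pos _).le)
    rw [hsplit]
    have hnrm : 0 < nrm (d := 4) (x' - p) ^ 3 := pow_pos (nrm_pos _) 3
    calc kG * (Real.exp (-(δ / 2 / n) * (supNorm (d := 4) (x' - p) : ℝ)) * Real.exp (-(δ / 2 / n) * (supNorm (d := 4) (x' - p) : ℝ)))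
          / nrm (d := 4) (x' - p) ^ 3
        = kG * Real.exp (-(δ / 2 / n) * (supNorm (d := 4) (x' - p) : ℝ))
            * (Real.exp (-(δ / 2 / n) * (supNorm (d := 4) (x' - p) : ℝ)) / nrm (d := 4) (x' - p) ^ 3) := by ring
      _ ≤ kG * (Real.exp δ * Real.exp (-(δ / 2 / n) * (supNorm (d := 4) (x' - (n : ℤ) • y₀) : ℝ)))
            * (Real.exp (-(δ / 2 / n) * (supNorm (d := 4) (x' - p) : ℝ)) / nrm (d := 4) (x' - p) ^ 3) := by
          gcongr
      _ = _ := by ring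
  -- sum over the box (HLS at `p = 3`, rate `δ∕2∕n`) and over the `n` steps
  have hbox : ∀ s ∈ Finset.range n,
      ∑ b ∈ box 4 n, Real.exp (-(δ / 2 / n) * (supNorm (d := 4) (x' - ((n : ℤ) • y₀ + toSite b + (s : ℤ) • unitVec m')) : ℝ))
          / nrm (d := 4) (x' - ((n : ℤ) • y₀ + toSite b + (s : ℤ) • unitVec m')) ^ 3
        ≤ (n : ℝ) * (217 + 432 / (δ / 2)) := by
    intro s _
    exact sum_box_profile_cube_le (δ := δ / 2) (half_pos hδ) n y₀ x' s m'
  set E : ℝ := kG * Real.exp δ * Real.exp (-(δ / 2 / n) * (supNorm (d := 4) (x' - (n : ℤ) • y₀) : ℝ)) with hE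
  have hE0 : 0 ≤ E := by positivity
  calc |∑ b ∈ box 4 n, ∑ s ∈ Finset.range n, (Ga n a ((n : ℤ) • y₀ + toSite b + (s : ℤ) • unitVec m') (x' + unitVec ρ') m' κ'
            - Ga n a ((n : ℤ) • y₀ + toSite b + (s : ℤ) • unitVec m') x' m' κ')|
      ≤ ∑ b ∈ box 4 n, ∑ s ∈ Finset.range n, |Ga n a ((n : ℤ) • y₀ + toSite b + (s : ℤ) • unitVec m') (x' + unitVec ρ') m' κ'
            - Ga n a ((n : ℤ) • y₀ + toSite b + (s : ℤ) • unitVec m') x' m' κ'| :=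
        (Finset.abs_sum_le_sum_abs _ _).trans (Finset.sum_le_sum fun b _ => Finset.abs_sum_le_sum_abs _ _)
    _ ≤ ∑ b ∈ box 4 n, ∑ s ∈ Finset.range n, E *
          (Real.exp (-(δ / 2 / n) * (supNorm (d := 4) (x' - ((n : ℤ) • y₀ + toSite b + (s : ℤ) • unitVec m')) : ℝ))
            / nrm (d := 4) (x' - ((n : ℤ) • y₀ + toSite b + (s : ℤ) • unitVec m')) ^ 3) :=
        Finset.sum_le_sum fun b hb => Finset.sum_le_sum fun s hs => hterm b hb s hs
    _ = E * ∑ s ∈ Finset.range n, ∑ b ∈ box 4 n,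
          Real.exp (-(δ / 2 / n) * (supNorm (d := 4) (x' - ((n : ℤ) • y₀ + toSite b + (s : ℤ) • unitVec m')) : ℝ))
            / nrm (d := 4) (x' - ((n : ℤ) • y₀ + toSite b + (s : ℤ) • unitVec m')) ^ 3 := by
        rw [Finset.sum_comm, Finset.mul_sum]
        refine Finset.sum_congr rfl fun s _ => ?_
        rw [Finset.mul_sum]
    _ ≤ E * ∑ _s ∈ Finset.range n, (n : ℝ) * (217 + 432 / (δ / 2)) :=
        mul_le_mul_of_nonneg_left (Finset.sum_le_sum hbox) hE0
    _ = (n : ℝ) ^ 2 * (kG * Real.exp δ * (217 + 432 / (δ / 2)))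
          * Real.exp (-(δ / 2 / n) * (supNorm (d := 4) (x' - (n : ℤ) • y₀) : ℝ)) := by
        rw [Finset.sum_const, Finset.card_range, nsmul_eq_mul, hE]
        ring

end Profile

end Summit.QuantumFields.BalabanUV.Beta.D1BFx.RestLegContourSumD1

end
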